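import Literature.AlgebraicGeometry.Motives.UniversalHypersurfaceFibre
import Literature.AlgebraicGeometry.HodgeTheory.MotivatedClassesDeformation
import HarnessLib

/-!
# The sub-family of the universal family of smooth hypersurfaces cut out by a coefficient specialisation

Family `hodge`, layer `Literature/AlgebraicGeometry/Motives`. Companion of
`MonomialSupportedHypersurfaceFamily` (the LINEAR sub-family of forms supported on a set of monomials):
here the sub-family is parametrised by an arbitrary affine space `𝔸^ι = Spec k[b_i | i ∈ ι]` through a
SURJECTIVE `k`-algebra map `φ : R = k[a_m | |m| = d] → k[b_i | i ∈ ι]` of coefficient rings — the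
comorphism of a closed immersion `𝔸^ι ↪ S^d` onto an AFFINE-LINEAR subspace of the space of forms of
degree `d` on `ℙⁿ⁺¹` (e.g. the forms `x₃^p − f(x₀, x₁, x₂)` of the Carlson–Toledo family of cyclic covers of
the plane, `a_{x₃^p} ↦ 1`, `a_{(e,0)} ↦ −b_e`, mixed coefficients `↦ 0`; file
`HodgeTheory/CyclicCoverUniversalFamily`). Written by the prover seat `hodge-nonav-prover-Ax` (g4) for
route `CyclicUnitaryPowers` of the Hodge summit (crux K1, stmt-HodgeConjecture-19544): the construction
half of the cited fact `nonempty_carlsonToledoFamily`.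

## The construction (Voisin, *Hodge Theory II*, §6.2.1; Hartshorne II §3 base change, Ex. 2.18, 3.11)

Fix a field `k`, `n d : ℕ`, an index type `ι` and `φ : CoeffRing k n d →ₐ[k] MvPolynomial ι k`.

* `specSpz φ : 𝔸^ι ⟶ S^d` — `Spec φ`; a closed immersion when `φ` is surjective
  (`isClosedImmersion_specSpz`).
* `baseSpzOpens φ = (Spec φ)⁻¹(U) ⊆ 𝔸^ι` — the parameters whose form is NONSINGULAR (`U = baseOpens k n d`);
  `baseSpz φ` the same as a `k`-scheme, `toBaseSpz φ : baseSpz φ ⟶ base k n d` the restriction of `Spec φ`.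
* `familySpz φ : totalSpz φ ⟶ baseSpz φ` — **the sub-family of the universal family of smooth
  hypersurfaces of degree `d` in `ℙⁿ⁺¹` parametrised through `φ`**: the base change
  (`Motives.familyPullback`) of `family k n d : 𝒴_U ⟶ U` along `toBaseSpz φ`.
* A form `G` BELONGS to the sub-family through a `k`-algebra map `ψ : k[b] → k` with `ψ ∘ φ = coeffHom G`
  (its coefficient vector factors through `φ`); `pointOfFormSpz` — the `k`-point `[G]_ψ ∈ baseSpz φ (k)`.

## What is proved

* `isSmoothProjectiveFamily_familySpz`: for `n ≥ 1`, `d ≥ 1`, `familySpz φ` is a smooth projective family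
  of relative dimension `n`.
* `map_toBaseSpz_pointOfFormSpz`: `toBaseSpz φ [G]_ψ = [G] ∈ U(k)`; `fiberOverFamilySpzIso`: **the fibre
  of `familySpz φ` over `[G]_ψ` is the hypersurface `X_G`**.
* `totalSpz φ ⟶ 𝒴_U` is a closed immersion for `φ` surjective (`isClosedImmersion_totalSpzToTotal_left`).

Companion file `HodgeTheory/SpecialisedHypersurfaceFamilyPoints`: the points of `S_φ` and their forms, the
base (smooth, separated, irreducible), and over `ℂ`: quasi-projectivity of base and total space, Ehresmann
local triviality, and Zariski-closed sets of points in the coordinates `b`.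

## References

* C. Voisin, *Hodge Theory and Complex Algebraic Geometry II* (2003), §6.2.1 (the universal smooth
  hypersurface `π : 𝒴 → B`). [VoisinHodgeII2003]
* R. Hartshorne, *Algebraic Geometry* (1977), II §3 (base extension, fibres), Ex. 2.18, Ex. 3.11,
  III §10. [Hartshorne1977]
* J. A. Carlson, D. Toledo, Discriminant complements and kernels of monodromy representations, Duke
  Math. J. 97 (1999), §2 (the universal family of cyclic covers). [CarlsonToledo1999]
-/

noncomputable section

open CategoryTheory AlgebraicGeometry MvPolynomial Limits

universe u

namespace Literature.AlgebraicGeometry.Motives.UniversalHypersurface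

/-! ### The coefficient specialisation `φ` and the closed subscheme `𝔸^ι ↪ S^d` -/

section Defs

variable (k : Type u) [Field k] (n d : ℕ) {ι : Type} (φ : CoeffRing k n d →ₐ[k] MvPolynomial ι k)

/-- **`Spec φ : 𝔸^ι ⟶ S^d`**, the morphism of affine spaces of a coefficient specialisation
`φ : k[a_m | |m| = d] → k[b_i | i ∈ ι]`. [cite: Hartshorne1977, II Ex. 2.18(c)–(d)] -/
abbrev specSpz : Spec (.of (MvPolynomial ι k)) ⟶ Spec (.of (CoeffRing k n d)) :=
  Spec.map (CommRingCat.ofHom φ.toRingHom)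

/-- `𝔸^ι ⟶ S^d` is a closed immersion when `φ` is surjective. [cite: Hartshorne1977, II Ex. 2.18(c)–(d)] -/
theorem isClosedImmersion_specSpz (hφ : Function.Surjective φ) : IsClosedImmersion (specSpz k n d φ) :=
  IsClosedImmersion.spec_of_surjective _ hφ

/-- The structure morphism `𝔸^ι = Spec k[b] → Spec k`. [cite: Hartshorne1977, II §3 (schemes over `S`), p. 89] -/
abbrev specSpzToSpec : Spec (.of (MvPolynomial ι k)) ⟶ Spec (.of k) :=
  Spec.map (CommRingCat.ofHom (algebraMap k (MvPolynomial ι k)))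

/-- `𝔸^ι ⟶ S^d → Spec k` is `𝔸^ι → Spec k` (`φ` is a `k`-algebra map). [cite: Hartshorne1977, II §3
(fibres and base extension), p. 89] -/
@[reassoc]
theorem specSpz_comp_specCoeffToSpec :
    specSpz k n d φ ≫ specCoeffToSpec k n d = specSpzToSpec k (ι := ι) := by
  rw [← Spec.map_comp, ← CommRingCat.ofHom_comp]
  congr 2
  exact RingHom.ext fun r => φ.commutes r

/-! ### The base `baseSpz φ`: parameters with nonsingular form -/

/-- **The Zariski open set of parameters `b ∈ 𝔸^ι` whose form is nonsingular**: the preimage of the open set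
`U ⊆ S^d` of nonsingular forms (`baseOpens`, Voisin II §6.2.1) under `Spec φ`. [cite: VoisinHodgeII2003, §6.2.1] -/
abbrev baseSpzOpens : (Spec (CommRingCat.of (MvPolynomial ι k))).Opens :=
  specSpz k n d φ ⁻¹ᵁ baseOpens k n d

/-- Membership in `baseSpzOpens`: the image in `S^d` is a nonsingular form (`Iff.rfl`).
[cite: VoisinHodgeII2003, §6.2.1] -/
theorem mem_baseSpzOpens_iff (x : Spec (CommRingCat.of (MvPolynomial ι k))) :
    x ∈ baseSpzOpens k n d φ ↔ specSpz k n d φ x ∈ baseOpens k n d :=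
  Iff.rfl

/-- **The base `S_φ` of the specialised family as a `k`-scheme**: the open subscheme of `𝔸^ι` of
parameters with nonsingular form, with structure map `S_φ ⊆ 𝔸^ι → Spec k`. [cite: VoisinHodgeII2003, §6.2.1] -/
def baseSpz : SchemeOver k := Over.mk ((baseSpzOpens k n d φ).ι ≫ specSpzToSpec k (ι := ι))

/-- The underlying scheme of `baseSpz φ` is the open subscheme `baseSpzOpens φ` (`rfl`).
[cite: VoisinHodgeII2003, §6.2.1] -/
theorem baseSpz_left : (baseSpz k n d φ).left = (baseSpzOpens k n d φ).toScheme := rfl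

/-- The structure map of `baseSpz φ` is `S_φ ⊆ 𝔸^ι → Spec k` (`rfl`). [cite: VoisinHodgeII2003, §6.2.1] -/
theorem baseSpz_hom : (baseSpz k n d φ).hom = (baseSpzOpens k n d φ).ι ≫ specSpzToSpec k (ι := ι) := rfl

/-- **The morphism of bases `S_φ ⟶ U`**: the restriction of `Spec φ` over the open set `U` of nonsingular
forms (Mathlib `morphismRestrict`), as a morphism of `k`-schemes. [cite: Hartshorne1977, II §3 (fibres and
base extension), p. 89] -/
def toBaseSpz : baseSpz k n d φ ⟶ base k n d :=
  Over.homMk (specSpz k n d φ ∣_ baseOpens k n d) (by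
    change (specSpz k n d φ ∣_ baseOpens k n d) ≫ (baseOpens k n d).ι ≫ specCoeffToSpec k n d =
      (baseSpzOpens k n d φ).ι ≫ specSpzToSpec k
    rw [morphismRestrict_ι_assoc, specSpz_comp_specCoeffToSpec])

/-- The underlying morphism of `toBaseSpz φ` is the restricted `Spec φ` (`rfl`). [cite: Hartshorne1977, II §3
(fibres and base extension), p. 89] -/
theorem toBaseSpz_left : (toBaseSpz k n d φ).left = specSpz k n d φ ∣_ baseOpens k n d := rfl

/-- `S_φ ⟶ U ⊆ S^d` is `S_φ ⊆ 𝔸^ι ⟶ S^d`. [cite: Hartshorne1977, II §3 (fibres and base extension), p. 89] -/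
@[reassoc]
theorem toBaseSpz_left_comp_ι :
    (toBaseSpz k n d φ).left ≫ (baseOpens k n d).ι = (baseSpzOpens k n d φ).ι ≫ specSpz k n d φ :=
  morphismRestrict_ι _ _

/-- `S_φ ⟶ U` is a closed immersion when `φ` is surjective (base change of the closed immersion
`𝔸^ι ↪ S^d` to the open `U`). [cite: Hartshorne1977, II Ex. 3.11(a)] -/
theorem isClosedImmersion_toBaseSpz_left (hφ : Function.Surjective φ) :
    IsClosedImmersion (toBaseSpz k n d φ).left := by
  rw [toBaseSpz_left]
  exact IsZariskiLocalAtTarget.restrict (P := @IsClosedImmersion) (isClosedImmersion_specSpz k n d φ hφ) _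

/-! ### The family `familySpz φ : totalSpz φ ⟶ baseSpz φ` -/

/-- **The total space `𝒴_φ = 𝒴_U ×_U S_φ`** of the specialised family: the base change of the universal
smooth hypersurface along `S_φ ⟶ U` (`Motives.familyPullback`). [cite: Hartshorne1977, II §3 (base extension)] -/
def totalSpz : SchemeOver k := familyPullback (family k n d) (toBaseSpz k n d φ)

/-- **The specialised family of smooth hypersurfaces of degree `d` in `ℙⁿ⁺¹_k`**, `π_φ : 𝒴_φ ⟶ S_φ`: the
base change of the universal family `π : 𝒴_U → U` (Voisin II, §6.2.1) along `S_φ ⟶ U`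
(`Motives.familyPullback.snd`). [cite: VoisinHodgeII2003, §6.2.1] -/
def familySpz : totalSpz k n d φ ⟶ baseSpz k n d φ := familyPullback.snd (family k n d) (toBaseSpz k n d φ)

/-- The projection `𝒴_φ ⟶ 𝒴_U` of the base change (`Motives.familyPullback.fst`). [cite: Hartshorne1977, II
§3 (fibres and base extension), p. 89] -/
def totalSpzToTotal : totalSpz k n d φ ⟶ total k n d := familyPullback.fst (family k n d) (toBaseSpz k n d φ)

/-- `familySpz φ` is literally `familyPullback.snd (family k n d) (toBaseSpz φ)` (`rfl`).
[cite: Hartshorne1977, II §3 (fibres and base extension), p. 89] -/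
theorem familySpz_eq : familySpz k n d φ = familyPullback.snd (family k n d) (toBaseSpz k n d φ) := rfl

/-- The base-change square `𝒴_φ ⟶ 𝒴_U ⟶ U = 𝒴_φ ⟶ S_φ ⟶ U` commutes. [cite: Hartshorne1977, II §3 (fibres
and base extension), p. 89] -/
@[reassoc]
theorem totalSpzToTotal_comp_family :
    totalSpzToTotal k n d φ ≫ family k n d = familySpz k n d φ ≫ toBaseSpz k n d φ :=
  familyPullback.condition _ _

/-- The base-change square is cartesian in `k`-schemes. [cite: Hartshorne1977, II Thm. 3.3 and §3 (base
extension), p. 89] -/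
theorem isPullback_totalSpz :
    IsPullback (totalSpzToTotal k n d φ) (familySpz k n d φ) (family k n d) (toBaseSpz k n d φ) :=
  familyPullback.isPullback _ _

/-- **`𝒴_φ ⟶ 𝒴_U` is a closed immersion when `φ` is surjective** (base change of the closed immersion
`S_φ ⟶ U` along `π`). [cite: Hartshorne1977, II Ex. 3.11(a)] -/
theorem isClosedImmersion_totalSpzToTotal_left (hφ : Function.Surjective φ) :
    IsClosedImmersion (totalSpzToTotal k n d φ).left := by
  haveI := isClosedImmersion_toBaseSpz_left k n d φ hφ
  change IsClosedImmersion (pullback.fst (family k n d).left (toBaseSpz k n d φ).left)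
  infer_instance

/-- **`π_φ : 𝒴_φ ⟶ S_φ` is a smooth projective family of relative dimension `n`** for `n ≥ 1`, `d ≥ 1`: base
change (`IsSmoothProjectiveFamily.familyPullback_snd`) of the smooth projective universal family
(`isSmoothProjectiveFamily_family`). [cite: VoisinHodgeII2003, §6.2.1] -/
theorem isSmoothProjectiveFamily_familySpz (hn : 1 ≤ n) (hd : 1 ≤ d) :
    IsSmoothProjectiveFamily (familySpz k n d φ) n :=
  (isSmoothProjectiveFamily_family k hn hd).familyPullback_snd _

end Defs

/-! ### The point `[G]_ψ ∈ S_φ(k)` of a nonsingular form of the sub-family -/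

section OfForm

variable (k : Type u) [Field k] (n d : ℕ) {ι : Type} (φ : CoeffRing k n d →ₐ[k] MvPolynomial ι k)

/-- For a form `G` whose coefficient vector factors as `ψ ∘ φ`, `[G]_ψ ∈ 𝔸^ι` maps to `[G] ∈ S^d`:
`Spec ψ ≫ Spec φ = Spec (coeffHom G)`. [cite: VoisinHodgeII2003, §6.2.1] -/
@[reassoc]
theorem specMap_comp_specSpz {G : MvPolynomial (Fin (n + 2)) k} {ψ : MvPolynomial ι k →ₐ[k] k}
    (hψ : ψ.comp φ = coeffHom k n d G) :
    Spec.map (CommRingCat.ofHom ψ.toRingHom) ≫ specSpz k n d φ =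
      Spec.map (CommRingCat.ofHom (coeffHom k n d G).toRingHom) := by
  rw [← Spec.map_comp, ← CommRingCat.ofHom_comp]
  congr 2
  exact congrArg AlgHom.toRingHom hψ

/-- **The point `[G]_ψ ∈ 𝔸^ι(k)` of a nonsingular form of the sub-family lies in `S_φ`**: its image in `S^d`
is the point `[G]`, which lies in `U` (`specMap_coeffHom_apply_mem_baseOpens`, Hartshorne I Ex. 5.8).
[cite: Hartshorne1977, I Ex. 5.8] -/
theorem specMap_apply_mem_baseSpzOpens {G : MvPolynomial (Fin (n + 2)) k}
    (hG : G.IsHomogeneous d) (hJ : SmoothHypersurface.IsNonsingularForm k G)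
    {ψ : MvPolynomial ι k →ₐ[k] k} (hψ : ψ.comp φ = coeffHom k n d G) (y : Spec (.of k)) :
    Spec.map (CommRingCat.ofHom ψ.toRingHom) y ∈ baseSpzOpens k n d φ := by
  rw [mem_baseSpzOpens_iff, ← Scheme.Hom.comp_apply, specMap_comp_specSpz k n d φ hψ]
  exact specMap_coeffHom_apply_mem_baseOpens k n d hG hJ y

/-- The morphism `Spec k → S_φ` of a nonsingular form of the sub-family: `[G]_ψ ∈ 𝔸^ι` lifted through the
open immersion `S_φ ⊆ 𝔸^ι` (Mathlib `IsOpenImmersion.lift`). [cite: VoisinHodgeII2003, §6.2.1] -/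
def pointOfFormSpzHom {G : MvPolynomial (Fin (n + 2)) k} (hG : G.IsHomogeneous d)
    (hJ : SmoothHypersurface.IsNonsingularForm k G) {ψ : MvPolynomial ι k →ₐ[k] k}
    (hψ : ψ.comp φ = coeffHom k n d G) :
    Spec (.of k) ⟶ (baseSpzOpens k n d φ).toScheme :=
  IsOpenImmersion.lift (baseSpzOpens k n d φ).ι (Spec.map (CommRingCat.ofHom ψ.toRingHom))
    (by
      rintro _ ⟨y, rfl⟩
      rw [Scheme.Opens.range_ι]
      exact specMap_apply_mem_baseSpzOpens k n d φ hG hJ hψ y)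

/-- `pointOfFormSpzHom` followed by `S_φ ⊆ 𝔸^ι` is the point `[G]_ψ` of `𝔸^ι`. [cite: VoisinHodgeII2003, §6.2.1] -/
@[reassoc]
theorem pointOfFormSpzHom_ι {G : MvPolynomial (Fin (n + 2)) k} (hG : G.IsHomogeneous d)
    (hJ : SmoothHypersurface.IsNonsingularForm k G) {ψ : MvPolynomial ι k →ₐ[k] k}
    (hψ : ψ.comp φ = coeffHom k n d G) :
    pointOfFormSpzHom k n d φ hG hJ hψ ≫ (baseSpzOpens k n d φ).ι = Spec.map (CommRingCat.ofHom ψ.toRingHom) :=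
  IsOpenImmersion.lift_fac _ _ _

/-- **The point `[G]_ψ ∈ S_φ(k)` of a nonsingular form `G` of degree `d` of the sub-family** (coefficient
vector `ψ ∘ φ`), as a `k`-point of the base. [cite: VoisinHodgeII2003, §6.2.1] -/
def pointOfFormSpz {G : MvPolynomial (Fin (n + 2)) k} (hG : G.IsHomogeneous d)
    (hJ : SmoothHypersurface.IsNonsingularForm k G) {ψ : MvPolynomial ι k →ₐ[k] k}
    (hψ : ψ.comp φ = coeffHom k n d G) :
    AlgPoints (baseSpz k n d φ) k :=
  AlgPoints.mk (X := baseSpz k n d φ) (pointOfFormSpzHom k n d φ hG hJ hψ)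
    (by
      have hc : ψ.toRingHom.comp (algebraMap k (MvPolynomial ι k)) = algebraMap k k :=
        RingHom.ext fun r => ψ.commutes r
      change (pointOfFormSpzHom k n d φ hG hJ hψ ≫ (baseSpzOpens k n d φ).ι) ≫ specSpzToSpec k = _
      rw [pointOfFormSpzHom_ι, ← Spec.map_comp, ← CommRingCat.ofHom_comp, hc])

/-- The underlying morphism of `[G]_ψ ∈ S_φ(k)` is `pointOfFormSpzHom` (`rfl`). [cite: VoisinHodgeII2003, §6.2.1] -/
theorem pointOfFormSpz_left {G : MvPolynomial (Fin (n + 2)) k} (hG : G.IsHomogeneous d)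
    (hJ : SmoothHypersurface.IsNonsingularForm k G) {ψ : MvPolynomial ι k →ₐ[k] k}
    (hψ : ψ.comp φ = coeffHom k n d G) :
    (pointOfFormSpz k n d φ hG hJ hψ).left = pointOfFormSpzHom k n d φ hG hJ hψ := rfl

/-- `[G]_ψ ∈ S_φ(k)` followed by `S_φ ⊆ 𝔸^ι` is the point `[G]_ψ` of `𝔸^ι`. [cite: VoisinHodgeII2003, §6.2.1] -/
@[reassoc]
theorem pointOfFormSpz_left_comp_ι {G : MvPolynomial (Fin (n + 2)) k} (hG : G.IsHomogeneous d)
    (hJ : SmoothHypersurface.IsNonsingularForm k G) {ψ : MvPolynomial ι k →ₐ[k] k}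
    (hψ : ψ.comp φ = coeffHom k n d G) :
    (pointOfFormSpz k n d φ hG hJ hψ).left ≫ (baseSpzOpens k n d φ).ι =
      Spec.map (CommRingCat.ofHom ψ.toRingHom) :=
  pointOfFormSpzHom_ι k n d φ hG hJ hψ

/-- **`S_φ ⟶ U` sends `[G]_ψ ∈ S_φ(k)` to `[G] ∈ U(k)`** (`pointOfForm`): both are `Spec k → U` followed by
`U ⊆ S^d` equal to the point `[G]` of `S^d`, and `U ⊆ S^d` is a monomorphism. [cite: VoisinHodgeII2003, §6.2.1] -/
theorem map_toBaseSpz_pointOfFormSpz {G : MvPolynomial (Fin (n + 2)) k} (hG : G.IsHomogeneous d)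
    (hJ : SmoothHypersurface.IsNonsingularForm k G) {ψ : MvPolynomial ι k →ₐ[k] k}
    (hψ : ψ.comp φ = coeffHom k n d G) :
    AlgPoints.map (toBaseSpz k n d φ) (pointOfFormSpz k n d φ hG hJ hψ) = pointOfForm k n d hG hJ := by
  have e1 : (AlgPoints.map (toBaseSpz k n d φ) (pointOfFormSpz k n d φ hG hJ hψ)).left ≫ (baseOpens k n d).ι =
      Spec.map (CommRingCat.ofHom (coeffHom k n d G).toRingHom) := by
    show (pointOfFormSpzHom k n d φ hG hJ hψ ≫ (specSpz k n d φ ∣_ baseOpens k n d)) ≫ (baseOpens k n d).ι = _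
    rw [Category.assoc, morphismRestrict_ι, pointOfFormSpzHom_ι_assoc, specMap_comp_specSpz k n d φ hψ]
  have e2 : (pointOfForm k n d hG hJ).left ≫ (baseOpens k n d).ι =
      Spec.map (CommRingCat.ofHom (coeffHom k n d G).toRingHom) :=
    pointOfFormHom_ι k n d hG hJ
  exact Over.OverMorphism.ext ((cancel_mono (baseOpens k n d).ι).mp (e1.trans e2.symm))

/-- **The fibre of the specialised family over `[G]_ψ` is the hypersurface `X_G`** (`d ≥ 1`): the fibre of a
base change is the fibre of the original family over the image point (`fiberOverFamilyPullbackIso`), that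
point is `[G] ∈ U(k)` (`map_toBaseSpz_pointOfFormSpz`), and the fibre of the universal family over `[G]` is
`X_G` (`nonempty_fiberOver_iso_hypersurface`, `pointForm_pointOfForm`). A chosen isomorphism of `k`-schemes.
[cite: VoisinHodgeII2003, §6.2.1] -/
def fiberOverFamilySpzIso (hd : 0 < d) {G : MvPolynomial (Fin (n + 2)) k} (hG : G.IsHomogeneous d)
    (hJ : SmoothHypersurface.IsNonsingularForm k G) {ψ : MvPolynomial ι k →ₐ[k] k}
    (hψ : ψ.comp φ = coeffHom k n d G) :
    fiberOver (familySpz k n d φ) (pointOfFormSpz k n d φ hG hJ hψ) ≅ SmoothHypersurface.hypersurface G :=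
  fiberOverFamilyPullbackIso (family k n d) (toBaseSpz k n d φ) (pointOfFormSpz k n d φ hG hJ hψ) ≪≫
    eqToIso (congrArg (fiberOver (family k n d)) (map_toBaseSpz_pointOfFormSpz k n d φ hG hJ hψ)) ≪≫
      (nonempty_fiberOver_iso_hypersurface k n d (pointOfForm k n d hG hJ) hd).some ≪≫
        eqToIso (congrArg SmoothHypersurface.hypersurface (pointForm_pointOfForm k n d hG hJ))

/-- Hence the fibre of the specialised family over `[G]_ψ` is isomorphic to `X_G` (the `Nonempty` form).
[cite: VoisinHodgeII2003, §6.2.1] -/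
theorem nonempty_fiberOver_familySpz_iso_hypersurface (hd : 0 < d) {G : MvPolynomial (Fin (n + 2)) k}
    (hG : G.IsHomogeneous d) (hJ : SmoothHypersurface.IsNonsingularForm k G)
    {ψ : MvPolynomial ι k →ₐ[k] k} (hψ : ψ.comp φ = coeffHom k n d G) :
    Nonempty (fiberOver (familySpz k n d φ) (pointOfFormSpz k n d φ hG hJ hψ) ≅ SmoothHypersurface.hypersurface G) :=
  ⟨fiberOverFamilySpzIso k n d φ hd hG hJ hψ⟩

end OfForm
end Literature.AlgebraicGeometry.Motives.UniversalHypersurface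

end
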